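import Summits.ResolutionOfSingularities.ResolutionOfSingularities.Theorems.InductiveStep.Negative.TorusLegDegeneration
import Summits.ResolutionOfSingularities.ResolutionOfSingularities.Theorems.InductiveStep.Negative.NotInductiveStepIff
import Literature.AlgebraicGeometry.Resolution.RegularLocalRingsProofs

/-!
# Crux `InductiveStep` (stmt-ResolutionOfSingularities-17233) — negative knowledge: a NON-SCHÖN
# re-embedding (the node), i.e. the schön clause of `SchonAt` FAILING for a bad choice of the unit `G`

Route `ResolutionOfSingularities/TropicalLinks`, crux `InductiveStep` (≡ `SchonPlus`), line `split`
(cdisprove seat, gen 2 / cycle 1, part 4).  By `TorusLegDegeneration.lean` the degeneration of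
`U[G₀⁻¹]`, `U = 𝔾_m^N`, at the leg weight `w = (0,…,0,1)` is `V(G₀) × 𝔾_m`:
`in_w⟨ι(⊥), y − ι G₀⟩ = (ι G₀)`.  Take `N = 2` and the NODE `G₀ = (x₁ − 1)(x₂ − 1)`:

* `inductiveStep_torusLegNode_exists_not_regular` — `k[ℤ^(2+1)] ⧸ (ι G₀)` has a prime (the image of
  the augmentation ideal, the point `(1,1,1)`) whose localization is NOT a regular local ring (it is not
  even a domain: `ι(x₁ − 1) · ι(x₂ − 1) = 0` with both factors nonzero there; Matsumura 14.3 in the tree,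
  `Literature…isDomain_of_isRegularLocalRing`);
* `inductiveStep_torusLegNode_schonClause_false` — hence the schön clause of `SchonAt` (the route's
  INLINED `∀ w P, IsRegularLocalRing (Localization.AtPrime P)`) FAILS for the datum
  `(k, N = 2, I = ⊥, m = 1, G₀)`, for every field `k`: the first kernel-certified NON-schön re-embedding
  in the tree;
* `inductiveStep_not_schonClause_forall_units` — **REFUTED NATURAL STRENGTHENING**: "for the torus
  `U = 𝔾_m^N` (`I = ⊥`, prime, `d = N`; `SchonAt` holds for it trivially with `m = 0`) EVERY single unit
  `G₀ ∉ I` gives a schön re-embedding `U[G₀⁻¹] ⊆ 𝔾_m^(N+1)`" is FALSE under all guards of the crux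
  (`p = 2`, `k = 𝔽̄₂`, `N = 2`, the node).

MEANING.  The `∃ (m, G)` of `SchonAt` is load-bearing in the strong sense: removing a hypersurface
re-embeds its LINK one dimension down as the leg degeneration `V(G_j) ∩ U` (times a torus), so every
`V(G_j) ∩ U` — and, reading the further legs, each of ITS initial degenerations — must be regular:
the new boundary must itself be schön in `U`'s torus.  This is step (iii) ("Bertini makes the new
boundary divisors smooth") and the "link repair" of step (ii) of the crux's intended proof; neither can
be skipped, and a unit adjoined to repair one cone can break another (here: the cone `0` of `Trop U`
acquires a singular leg).  For provers of `stub_sncClosureSchon`: the generic sections `E` of Luxton–Qu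
§3 are exactly what keeps the legs (the strata `D_i ∩ E`) smooth.
-/

-- single-problem summit: the doubled namespace component `ResolutionOfSingularities` is forced
set_option linter.dupNamespace false

namespace Summit.ResolutionOfSingularities.ResolutionOfSingularities.Theorems.InductiveStep.Negative

open AddMonoidAlgebra Literature.AlgebraicGeometry.Tropical
open scoped Classical

/-- `xᵢ − 1 ≠ 0` in `k[ℤ²]`. [folklore] -/
theorem inductiveStep_torusLegNode_factor_ne_zero (k : Type) [Field k] (i : Fin 2) :
    (AddMonoidAlgebra.single (Pi.single i (1 : ℤ)) (1 : k) - 1 : AddMonoidAlgebra k (Fin 2 → ℤ)) ≠ 0 := by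
  intro h0
  rw [sub_eq_zero] at h0
  have h2 := congrArg (fun g : AddMonoidAlgebra k (Fin 2 → ℤ) => g.coeff (Pi.single i (1 : ℤ))) h0
  have h10 : (Pi.single i (1 : ℤ) : Fin 2 → ℤ) ≠ 0 := by
    intro h
    have := congrFun h i
    simp at this
  simp only [one_def, coeff_single, Finsupp.single_eq_same] at h2
  rw [Finsupp.single_eq_of_ne h10] at h2
  exact one_ne_zero h2

/-- The node `(x₁ − 1)(x₂ − 1) ≠ 0` in `k[ℤ²]` (so it passes the guard `G₀ ∉ ⊥`). [folklore] -/
theorem inductiveStep_torusLegNode_ne_zero (k : Type) [Field k] : ((AddMonoidAlgebra.single (Pi.single (0 : Fin 2) (1 : ℤ)) (1 : k) - 1) * (AddMonoidAlgebra.single (Pi.single (1 : Fin 2) (1 : ℤ)) (1 : k) - 1) : AddMonoidAlgebra k (Fin 2 → ℤ)) ≠ 0 :=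
  mul_ne_zero (inductiveStep_torusLegNode_factor_ne_zero k 0) (inductiveStep_torusLegNode_factor_ne_zero k 1)

set_option maxHeartbeats 800000 in
/-- **The node is not regular.** In `k[ℤ^(2+1)]` let `G₀ = (x₁ − 1)(x₂ − 1) ∈ k[ℤ²]` and
`J = (ι G₀)`.  Then some prime of `k[ℤ^(2+1)] ⧸ J` (the point `x₁ = x₂ = y = 1`) has a NON-regular
localization: `ι(x₁ − 1)` and `ι(x₂ − 1)` are nonzero zero-divisors there, while a regular local ring
is a domain (Matsumura 14.3). [folklore] -/
theorem inductiveStep_torusLegNode_exists_not_regular (k : Type) [Field k] :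
    ∃ (P : Ideal (AddMonoidAlgebra k (Fin (2 + 1) → ℤ) ⧸ Ideal.span {(AddMonoidAlgebra.ofCoeff ((((AddMonoidAlgebra.single (Pi.single (0 : Fin 2) (1 : ℤ)) (1 : k) - 1) * (AddMonoidAlgebra.single (Pi.single (1 : Fin 2) (1 : ℤ)) (1 : k) - 1) : AddMonoidAlgebra k (Fin 2 → ℤ))).coeff.mapDomain fun v => Fin.append v (0 : Fin 1 → ℤ)) : AddMonoidAlgebra k (Fin (2 + 1) → ℤ))})) (_ : P.IsPrime),
      ¬ IsRegularLocalRing (Localization.AtPrime P) := by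
  -- the lattice embedding `ι` as a `k`-algebra map, agreeing with the route's inlined term
  let ιₐ : AddMonoidAlgebra k (Fin 2 → ℤ) →ₐ[k] AddMonoidAlgebra k (Fin (2 + 1) → ℤ) :=
    AddMonoidAlgebra.mapDomainAlgHom k k
      { toFun := fun v => Fin.append v (0 : Fin 1 → ℤ)
        map_zero' := by
          funext i
          exact Fin.addCases (fun i => by rw [Fin.append_left]; rfl) (fun i => by rw [Fin.append_right]; rfl) i
        map_add' := fun u v => by
          have := inductiveStep_torusLeg_append_add 2 u v 0 0
          rwa [add_zero] at this }
  have hι : ∀ f : AddMonoidAlgebra k (Fin 2 → ℤ), ιₐ f =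
      AddMonoidAlgebra.ofCoeff (f.coeff.mapDomain fun v => Fin.append v (0 : Fin 1 → ℤ)) := fun f => rfl
  have hι_single : ∀ (v : Fin 2 → ℤ) (c : k), ιₐ (single v c) = single (Fin.append v (0 : Fin 1 → ℤ)) c := by
    intro v c
    rw [AddMonoidAlgebra.mapDomainAlgHom_apply, AddMonoidAlgebra.mapDomain_single]
    rfl
  clear_value ιₐ
  rw [← hι]
  -- names: `a = x₁ − 1`, `b = x₂ − 1`
  set a : AddMonoidAlgebra k (Fin 2 → ℤ) := single (Pi.single (0 : Fin 2) (1 : ℤ)) (1 : k) - 1 with ha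
  set b : AddMonoidAlgebra k (Fin 2 → ℤ) := single (Pi.single (1 : Fin 2) (1 : ℤ)) (1 : k) - 1 with hb
  rw [map_mul]
  -- the augmentation `ε : k[ℤ³] → k` (the point `(1,1,1)`) and its kernel `𝔪`
  let ε : AddMonoidAlgebra k (Fin (2 + 1) → ℤ) →ₐ[k] k := AddMonoidAlgebra.lift k k (Fin (2 + 1) → ℤ) 1
  have hε_single : ∀ (v : Fin (2 + 1) → ℤ) (c : k), ε (single v c) = c := by
    intro v c
    simp [ε]
  have hε_surj : Function.Surjective ε.toRingHom := fun c =>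
    ⟨single 0 c, hε_single 0 c⟩
  set 𝔪 : Ideal (AddMonoidAlgebra k (Fin (2 + 1) → ℤ)) := RingHom.ker ε.toRingHom with h𝔪
  haveI h𝔪max : 𝔪.IsMaximal := RingHom.ker_isMaximal_of_surjective _ hε_surj
  have hιa : ιₐ a ∈ 𝔪 := by
    rw [h𝔪, RingHom.mem_ker, ha, map_sub, map_one, hι_single]
    simp only [AlgHom.toRingHom_eq_coe, RingHom.coe_coe, map_sub, map_one, hε_single, sub_self]
  have hιb : ιₐ b ∈ 𝔪 := by
    rw [h𝔪, RingHom.mem_ker, hb, map_sub, map_one, hι_single]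
    simp only [AlgHom.toRingHom_eq_coe, RingHom.coe_coe, map_sub, map_one, hε_single, sub_self]
  -- `ι a ≠ 0`, `ι b ≠ 0`
  have hι_inj : Function.Injective ιₐ := by
    have hinjF : Function.Injective (fun v : Fin 2 → ℤ => Fin.append v (0 : Fin 1 → ℤ)) := by
      intro u v huv
      funext i
      have := congrFun huv (Fin.castAdd 1 i)
      simpa only [Fin.append_left] using this
    intro f g hfg
    have h1 := congrArg AddMonoidAlgebra.coeff hfg
    rw [hι, hι] at h1
    exact coeff_injective (Finsupp.mapDomain_injective hinjF h1)
  have hne := inductiveStep_torusLegNode_factor_ne_zero k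
  have ha0 : ιₐ a ≠ 0 := fun h => hne 0 (hι_inj (by rw [h, map_zero]))
  have hb0 : ιₐ b ≠ 0 := fun h => hne 1 (hι_inj (by rw [h, map_zero]))
  -- the prime `P = 𝔪 / J` of the quotient
  set J : Ideal (AddMonoidAlgebra k (Fin (2 + 1) → ℤ)) := Ideal.span {ιₐ a * ιₐ b} with hJ
  have hJ𝔪 : J ≤ 𝔪 := by
    rw [hJ, Ideal.span_le, Set.singleton_subset_iff]
    exact Ideal.mul_mem_left _ _ hιb
  have hker : RingHom.ker (Ideal.Quotient.mk J) ≤ 𝔪 := by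
    rw [Ideal.mk_ker]
    exact hJ𝔪
  set P : Ideal (AddMonoidAlgebra k (Fin (2 + 1) → ℤ) ⧸ J) := 𝔪.map (Ideal.Quotient.mk J) with hP
  haveI hPprime : P.IsPrime := Ideal.map_isPrime_of_surjective Ideal.Quotient.mk_surjective hker
  refine ⟨P, hPprime, fun hreg => ?_⟩
  haveI : IsDomain (Localization.AtPrime P) :=
    Literature.AlgebraicGeometry.Resolution.isDomain_of_isRegularLocalRing (Localization.AtPrime P)
  -- nonzero zero-divisors in the localization
  have key : ∀ c d : AddMonoidAlgebra k (Fin (2 + 1) → ℤ), ιₐ a * ιₐ b = c * d → c ∈ 𝔪 → d ≠ 0 →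
      algebraMap (AddMonoidAlgebra k (Fin (2 + 1) → ℤ) ⧸ J) (Localization.AtPrime P)
        (Ideal.Quotient.mk J d) ≠ 0 := by
    intro c d hcd hc hd h0
    rw [IsLocalization.map_eq_zero_iff P.primeCompl] at h0
    obtain ⟨⟨s, hs⟩, hsd⟩ := h0
    obtain ⟨s', rfl⟩ := Ideal.Quotient.mk_surjective s
    change Ideal.Quotient.mk J s' * Ideal.Quotient.mk J d = 0 at hsd
    rw [← map_mul, Ideal.Quotient.eq_zero_iff_mem, hJ, Ideal.mem_span_singleton'] at hsd
    obtain ⟨t, ht⟩ := hsd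
    rw [hcd, ← mul_assoc] at ht
    have hs' : t * c = s' := mul_right_cancel₀ hd ht
    have hs'𝔪 : s' ∈ 𝔪 := hs' ▸ Ideal.mul_mem_left _ _ hc
    exact hs (Ideal.mem_map_of_mem (Ideal.Quotient.mk J) hs'𝔪)
  have hα := key (ιₐ b) (ιₐ a) (mul_comm _ _) hιb ha0
  have hβ := key (ιₐ a) (ιₐ b) rfl hιa hb0
  refine mul_ne_zero hα hβ ?_
  rw [← map_mul, ← map_mul, Ideal.Quotient.eq_zero_iff_mem.2 (hJ ▸ Ideal.mem_span_singleton_self _), map_zero]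

set_option maxHeartbeats 800000 in
/-- **NOT SCHÖN.** For every field `k`, the schön clause of `SchonAt` (the route's INLINED
`∀ w P, IsRegularLocalRing (Localization.AtPrime P)` over the degenerations `k[ℤ^(2+1)] ⧸ in_w(I')`) FAILS
for the datum `N = 2`, `I = ⊥` (`U = 𝔾_m²`, prime, `d = 2`), `m = 1`, `G₀ = (x₁ − 1)(x₂ − 1)` (the node,
`G₀ ∉ I`): at the leg weight `w = (0,0,1)` the degeneration is `V(G₀) × 𝔾_m` (two planes crossing along
a torus), by `inductiveStep_torusLeg_inIdeal_eq_span`, and it is not regular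
(`inductiveStep_torusLegNode_exists_not_regular`). [folklore] -/
theorem inductiveStep_torusLegNode_schonClause_false (k : Type) [Field k] :
    ¬ ∀ (w : Fin (2 + 1) → ℤ) (P : Ideal (AddMonoidAlgebra k (Fin (2 + 1) → ℤ) ⧸ Ideal.span ((fun f : AddMonoidAlgebra k (Fin (2 + 1) → ℤ) => AddMonoidAlgebra.ofCoeff (f.coeff.filter fun v : Fin (2 + 1) → ℤ => ∀ u ∈ f.coeff.support, ∑ i, w i * v i ≤ ∑ i, w i * u i)) '' (↑(Ideal.span ((fun f : AddMonoidAlgebra k (Fin 2 → ℤ) => (AddMonoidAlgebra.ofCoeff (f.coeff.mapDomain fun v => Fin.append v (0 : Fin 1 → ℤ)) : AddMonoidAlgebra k (Fin (2 + 1) → ℤ))) '' (↑(⊥ : Ideal (AddMonoidAlgebra k (Fin 2 → ℤ))) : Set (AddMonoidAlgebra k (Fin 2 → ℤ))) ∪ Set.range (fun j : Fin 1 => AddMonoidAlgebra.single (Fin.append (0 : Fin 2 → ℤ) (Pi.single j (1 : ℤ))) (1 : k) - AddMonoidAlgebra.ofCoeff (((fun _ : Fin 1 => ((AddMonoidAlgebra.single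 (Pi.single (0 : Fin 2) (1 : ℤ)) (1 : k) - 1) * (AddMonoidAlgebra.single (Pi.single (1 : Fin 2) (1 : ℤ)) (1 : k) - 1) : AddMonoidAlgebra k (Fin 2 → ℤ))) j).coeff.mapDomain fun v => Fin.append v (0 : Fin 1 → ℤ))))) : Set (AddMonoidAlgebra k (Fin (2 + 1) → ℤ)))))) [P.IsPrime],
      IsRegularLocalRing (Localization.AtPrime P) := by
  intro hclause
  obtain ⟨P, hP, hnot⟩ := inductiveStep_torusLegNode_exists_not_regular k
  -- ELABORATION TRAP (T3, cf. the crux's Disproof.lean): instantiating the inlined-statement theorems at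
  -- a LITERAL unit family `fun _ => <explicit Laurent polynomial>` makes `whnf` time out; generalize the
  -- family to an opaque `Gf` first.
  generalize hGf : (fun _ : Fin 1 => ((AddMonoidAlgebra.single (Pi.single (0 : Fin 2) (1 : ℤ)) (1 : k) - 1) * (AddMonoidAlgebra.single (Pi.single (1 : Fin 2) (1 : ℤ)) (1 : k) - 1) : AddMonoidAlgebra k (Fin 2 → ℤ))) = Gf at hclause
  have hG0 : Gf 0 = ((AddMonoidAlgebra.single (Pi.single (0 : Fin 2) (1 : ℤ)) (1 : k) - 1) * (AddMonoidAlgebra.single (Pi.single (1 : Fin 2) (1 : ℤ)) (1 : k) - 1) : AddMonoidAlgebra k (Fin 2 → ℤ)) := by rw [← hGf]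
  have hG : Gf 0 ≠ 0 := by rw [hG0]; exact inductiveStep_torusLegNode_ne_zero k
  have hEq := inductiveStep_torusLeg_inIdeal_eq_span k 2 Gf hG
  rw [hG0] at hEq
  refine hnot ((inductiveStep_forall_prime_congr ?_).1
    (hclause (Fin.append (0 : Fin 2 → ℤ) (1 : Fin 1 → ℤ))) P)
  exact (tropicalLinks_weightInitialIdeal_eq_span _ _ _).symm.trans hEq

set_option maxHeartbeats 800000 in
/-- **REFUTED NATURAL STRENGTHENING ("any unit works for the torus").** It is NOT true that, under the
guards of the crux (`p` prime, `k = k̄` of characteristic `p`), for the torus `U = 𝔾_m^N` (`I = ⊥`,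
prime, of dimension `d = N`; `SchonAt` holds for it with `m = 0`) EVERY single unit `G₀ ∉ I` yields a
re-embedding `U[G₀⁻¹] ⊆ 𝔾_m^(N+1)` with all initial degenerations regular (the displayed statement is
the `∀ w P`-clause of `SchonAt` for `(N, I := ⊥, m := 1, G)`).  Witness: `p = 2`, `k = 𝔽̄₂`, `N = 2`,
the node `G₀ = (x₁ − 1)(x₂ − 1)` (`inductiveStep_torusLegNode_schonClause_false`).  So in `SchonAt`
the units must be CHOSEN (their zero loci in `U`, the links re-appearing as leg degenerations, must be
regular — Bertini / link repair are load-bearing), and a schön `U` can lose schön-ness by removing a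
divisor. [folklore] -/
theorem inductiveStep_not_schonClause_forall_units :
    ¬ ∀ (p : ℕ), p.Prime → ∀ (k : Type) [Field k] [CharP k p] [IsAlgClosed k] (N : ℕ)
      (G : Fin 1 → AddMonoidAlgebra k (Fin N → ℤ)), (∀ j, G j ∉ (⊥ : Ideal (AddMonoidAlgebra k (Fin N → ℤ)))) →
      ∀ (w : Fin (N + 1) → ℤ) (P : Ideal (AddMonoidAlgebra k (Fin (N + 1) → ℤ) ⧸ Ideal.span ((fun f : AddMonoidAlgebra k (Fin (N + 1) → ℤ) => AddMonoidAlgebra.ofCoeff (f.coeff.filter fun v : Fin (N + 1) → ℤ => ∀ u ∈ f.coeff.support, ∑ i, w i * v i ≤ ∑ i, w i * u i)) '' (↑(Ideal.span ((fun f : AddMonoidAlgebra k (Fin N → ℤ) => (AddMonoidAlgebra.ofCoeff (f.coeff.mapDomain fun v => Fin.append v (0 : Fin 1 → ℤ)) : AddMonoidAlgebra k (Fin (N + 1) → ℤ))) '' (↑(⊥ : Ideal (AddMonoidAlgebra k (Fin N → ℤ))) : Set (AddMonoidAlgebra k (Fin N → ℤ))) ∪ Set.range (fun j : Fin 1 =>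 AddMonoidAlgebra.single (Fin.append (0 : Fin N → ℤ) (Pi.single j (1 : ℤ))) (1 : k) - AddMonoidAlgebra.ofCoeff ((G j).coeff.mapDomain fun v => Fin.append v (0 : Fin 1 → ℤ))))) : Set (AddMonoidAlgebra k (Fin (N + 1) → ℤ)))))) [P.IsPrime],
      IsRegularLocalRing (Localization.AtPrime P) := by
  intro h
  haveI : Fact (Nat.Prime 2) := ⟨Nat.prime_two⟩
  refine inductiveStep_torusLegNode_schonClause_false (AlgebraicClosure (ZMod 2)) ?_
  have hguard : ∀ j : Fin 1, (fun _ : Fin 1 => ((AddMonoidAlgebra.single (Pi.single (0 : Fin 2) (1 : ℤ)) (1 : AlgebraicClosure (ZMod 2)) - 1) * (AddMonoidAlgebra.single (Pi.single (1 : Fin 2) (1 : ℤ)) (1 : AlgebraicClosure (ZMod 2)) - 1) : AddMonoidAlgebra (AlgebraicClosure (ZMod 2)) (Fin 2 → ℤ))) j ∉ (⊥ : Ideal (AddMonoidAlgebra (AlgebraicClosure (ZMod 2)) (Fin 2 → ℤ))) :=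
    fun j hj => inductiveStep_torusLegNode_ne_zero (AlgebraicClosure (ZMod 2)) ((Submodule.mem_bot _).1 hj)
  -- trap T3 again: make the unit family opaque before instantiating `h`
  generalize hGf : (fun _ : Fin 1 => ((AddMonoidAlgebra.single (Pi.single (0 : Fin 2) (1 : ℤ)) (1 : AlgebraicClosure (ZMod 2)) - 1) * (AddMonoidAlgebra.single (Pi.single (1 : Fin 2) (1 : ℤ)) (1 : AlgebraicClosure (ZMod 2)) - 1) : AddMonoidAlgebra (AlgebraicClosure (ZMod 2)) (Fin 2 → ℤ))) = Gf at hguard ⊢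
  intro w P hP
  exact h 2 Nat.prime_two (AlgebraicClosure (ZMod 2)) 2 Gf hguard w P

end Summit.ResolutionOfSingularities.ResolutionOfSingularities.Theorems.InductiveStep.Negative
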